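import Mathlib
import Literature.MathematicalPhysics.QuantumFieldTheory.Balaban1983to89.B5FiberZero

/-!
# B5 p. 22 (Sect. C): «spectral properties of the Laplace operator Δ on the torus T_η» — symmetric,
# non-negative, kernel = the constant functions, positive on their orthogonal complement

Source: T. Bałaban, *Propagators and renormalization transformations for lattice gauge
theories. I*, Commun. Math. Phys. 95 (1984) 17–40 (`Balaban1984PropagatorsI`, "B5"), render
`b2b-balaban-ref1/pages/1984-cmp95-propagators-rt-I/…-p006-x2.png` (PDF page 6 = journal page 22),
read as an image.

## What the paper prints (verbatim, p. 22, after (1.25))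

«Now we use spectral properties of the Laplace operator Δ on the torus T_η. It is a symmetric,
non-negative operator, and 0 is its eigenvalue. Constant functions form the eigenspace corresponding
to the eigenvalue 0, and on the subspace orthogonal to constant functions the operator Δ is positive.
Hence it is an invertible operator and by Δ⁻¹ we denote its inverse on this subspace. We extend it
to the whole space by linearity, putting its value on constant functions equal to 0.»

## What is typed and certified here (kernel-checked, zero sorry)

For pass 7's position-space scalar Laplace operator `LapS N c = Σ_ν (∂_ν)ᴴ∂_ν` on any torus
`Tor N = Π_ν ℤ/N_ν` with lattice factor `c` (B5: `T_η`, `c = η⁻¹ ≠ 0`):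
* `LapS_isHermitian` — «It is a symmetric … operator»;
* `form_LapS`, `form_LapS_nonneg` — `⟨f, Δf⟩ = Σ_ν ‖∂_ν f‖² ≥ 0`: «non-negative»;
* `sdiff_const`, `LapS_const` — `Δ(const) = 0`: «0 is its eigenvalue» with constant eigenfunctions;
* `const_of_shift_invariant`, `sdiff_eq_zero_of_form`, `LapS_ker_const` — `Δf = 0 ⟹ f` constant
  (for `c ≠ 0`): «Constant functions form the eigenspace corresponding to the eigenvalue 0»;
* `LapS_pos` — `f ⊥ 1`, `f ≠ 0 ⟹ ⟨f, Δf⟩ > 0`: «on the subspace orthogonal to constant functions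
  the operator Δ is positive» (hence injective there; with `B5DivOrth.sum_LapS` it maps that
  finite-dimensional subspace into itself, so it is invertible on it — the `Δ⁻¹` of the text).

## What is NOT certified here

The operator `Δ⁻¹` itself as a typed position-space matrix (fiberwise it is pass 5's `lapSinv`),
and the rest of Sect. C ((1.24)–(1.28): the infimum `λ₀` and the projection (1.27)/(1.28)).
-/

open scoped BigOperators Matrix ComplexConjugate ComplexOrder
open Finset Complex Matrix

namespace Literature.MathematicalPhysics.QuantumFieldTheory.Balaban1983to89.B5LaplaceSpectral

open Literature.MathematicalPhysics.QuantumFieldTheory.Balaban1983to89.B5Prop11Plancherel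
open Literature.MathematicalPhysics.QuantumFieldTheory.Balaban1983to89.B5Action121

noncomputable section

variable {d : ℕ} (N : Fin d → ℕ) [hN : ∀ μ, NeZero (N μ)]

/-- «It is a symmetric … operator»: `Δ = Σ_ν ∂_ν^*∂_ν` is Hermitian. [cite: Balaban1984PropagatorsI, Sect. C p.22] -/
theorem LapS_isHermitian (c : ℂ) : (LapS N c).IsHermitian := by
  unfold Matrix.IsHermitian LapS
  rw [Matrix.conjTranspose_sum]
  exact Finset.sum_congr rfl fun ν _ => by
    rw [Matrix.conjTranspose_mul, Matrix.conjTranspose_conjTranspose]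

/-- `⟨f, Δf⟩ = Σ_ν ⟨∂_ν f, ∂_ν f⟩`. [folklore] -/
theorem form_LapS (c : ℂ) (f : Tor N → ℂ) :
    star f ⬝ᵥ (LapS N c *ᵥ f) = ∑ ν, star (sdiff N c ν *ᵥ f) ⬝ᵥ (sdiff N c ν *ᵥ f) := by
  simp only [LapS, Matrix.sum_mulVec, dotProduct_sum, ← Matrix.mulVec_mulVec, dotProduct_mulVec,
    ← Matrix.star_mulVec]

/-- «non-negative»: `⟨f, Δf⟩ ≥ 0`. [cite: Balaban1984PropagatorsI, Sect. C p.22] -/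
theorem form_LapS_nonneg (c : ℂ) (f : Tor N → ℂ) : 0 ≤ star f ⬝ᵥ (LapS N c *ᵥ f) := by
  rw [form_LapS]
  exact Finset.sum_nonneg fun ν _ => dotProduct_star_self_nonneg _

/-- `∂_ν(const) = 0`. [folklore] -/
theorem sdiff_const (c a : ℂ) (ν : Fin d) : sdiff N c ν *ᵥ (fun _ : Tor N => a) = 0 := by
  funext x
  rw [sdiff_mulVec]
  simp

/-- «0 is its eigenvalue»: `Δ(const) = 0`. [cite: Balaban1984PropagatorsI, Sect. C p.22] -/
theorem LapS_const (c a : ℂ) : LapS N c *ᵥ (fun _ : Tor N => a) = 0 := by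
  simp only [LapS, Matrix.sum_mulVec, ← Matrix.mulVec_mulVec, sdiff_const, Matrix.mulVec_zero,
    Finset.sum_const_zero]

/-- a function on the torus invariant under all unit shifts is constant. [folklore] -/
theorem const_of_shift_invariant (f : Tor N → ℂ) (h : ∀ ν x, f (x + unitVec N ν) = f x)
    (x : Tor N) : f x = f 0 := by
  have h1 : ∀ (ν : Fin d) (m : ℕ) (y : Tor N), f (y + m • unitVec N ν) = f y := by
    intro ν m
    induction m with
    | zero => intro y; simp
    | succ m ih => intro y; rw [add_smul, one_smul, ← add_assoc, h, ih]
  have hx : x = ∑ ν, (x ν).val • unitVec N ν := by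
    funext μ
    rw [Finset.sum_apply, Finset.sum_eq_single_of_mem μ (Finset.mem_univ μ)]
    · rw [Pi.smul_apply, unitVec, Pi.single_eq_same, nsmul_eq_mul, mul_one, ZMod.natCast_zmod_val]
    · intro c _ hc
      rw [Pi.smul_apply, unitVec, Pi.single_eq_of_ne (Ne.symm hc), smul_zero]
  have h2 : ∀ s : Finset (Fin d), f (∑ ν ∈ s, (x ν).val • unitVec N ν) = f 0 := by
    intro s
    induction s using Finset.induction_on with
    | empty => simp
    | insert ν s hν ih => rw [Finset.sum_insert hν, add_comm, h1, ih]
  rw [hx]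
  exact h2 _

/-- `⟨f, Δf⟩ = 0 ⟹ ∂_ν f = 0` for every `ν`. [folklore] -/
theorem sdiff_eq_zero_of_form (c : ℂ) (f : Tor N → ℂ) (h : star f ⬝ᵥ (LapS N c *ᵥ f) = 0)
    (ν : Fin d) : sdiff N c ν *ᵥ f = 0 := by
  rw [form_LapS] at h
  have h' := (Finset.sum_eq_zero_iff_of_nonneg
    (fun ν _ => dotProduct_star_self_nonneg (sdiff N c ν *ᵥ f))).mp h ν (Finset.mem_univ ν)
  exact dotProduct_star_self_eq_zero.mp h'

/-- `∂_ν f = 0` for all `ν` (and `c ≠ 0`) ⟹ `f` is constant. [folklore] -/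
theorem const_of_sdiff_eq_zero {c : ℂ} (hc : c ≠ 0) (f : Tor N → ℂ)
    (h : ∀ ν, sdiff N c ν *ᵥ f = 0) (x : Tor N) : f x = f 0 := by
  refine const_of_shift_invariant N f (fun ν y => ?_) x
  have h' := congrFun (h ν) y
  rw [sdiff_mulVec, Pi.zero_apply, mul_eq_zero, sub_eq_zero] at h'
  exact h'.resolve_left hc

/-- «Constant functions form the eigenspace corresponding to the eigenvalue 0»: `Δf = 0 ⟹ f` is
constant (`c ≠ 0`). [cite: Balaban1984PropagatorsI, Sect. C p.22] -/
theorem LapS_ker_const {c : ℂ} (hc : c ≠ 0) (f : Tor N → ℂ) (h : LapS N c *ᵥ f = 0) (x : Tor N) :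
    f x = f 0 := by
  refine const_of_sdiff_eq_zero N hc f (sdiff_eq_zero_of_form N c f ?_) x
  rw [h, dotProduct_zero]

/-- «on the subspace orthogonal to constant functions the operator Δ is positive»: `Σ_x f(x) = 0`,
`f ≠ 0 ⟹ ⟨f, Δf⟩ > 0` (`c ≠ 0`). [cite: Balaban1984PropagatorsI, Sect. C p.22] -/
theorem LapS_pos {c : ℂ} (hc : c ≠ 0) (f : Tor N → ℂ) (horth : ∑ x, f x = 0) (hf : f ≠ 0) :
    0 < star f ⬝ᵥ (LapS N c *ᵥ f) := by
  refine lt_of_le_of_ne (form_LapS_nonneg N c f) fun h0 => hf ?_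
  have hconst := const_of_sdiff_eq_zero N hc f (sdiff_eq_zero_of_form N c f h0.symm)
  have hsum : ∑ x : Tor N, f x = (Fintype.card (Tor N) : ℂ) * f 0 := by
    rw [Finset.sum_congr rfl fun x _ => hconst x, Finset.sum_const, Finset.card_univ, nsmul_eq_mul]
  have hcard : (Fintype.card (Tor N) : ℂ) ≠ 0 := by exact_mod_cast Fintype.card_ne_zero
  have h00 : f 0 = 0 := (mul_eq_zero.mp (hsum.symm.trans horth)).resolve_left hcard
  funext x
  rw [hconst x, h00, Pi.zero_apply]

end

end Literature.MathematicalPhysics.QuantumFieldTheory.Balaban1983to89.B5LaplaceSpectral
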